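import Summits.BirchSwinnertonDyer.BirchSwinnertonDyer.Theorems.Rank2ObservatoryRank3TwoIsogenyGraph
import Summits.BirchSwinnertonDyer.BirchSwinnertonDyer.Theorems.Rank2ObservatoryRank3MinimalTotal
import Literature.NumberTheory.EllipticCurves.ComplexMultiplicationBSDTripleIsogenyProofs
import Literature.NumberTheory.EllipticCurves.SelmerCorankIsogenyProofs
import Literature.NumberTheory.EllipticCurves.BSDQuadraticDescent
import HarnessLib

/-!
# BSD along the `2`-isogeny graph of the rank-3 census: `986` curves, `473` classes

HONEST FRAMING: per-curve certified theorems and census instruments; no claim on BSD in rank ≥ 2.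

## Setting

KCI row 47 (`Rank2ObservatoryRank3TwoIsogenyGraph`) certified, hypothesis-free, the `2`-isogeny graph of the `986` curves of
the rank-3 table `rank3Table` (N < 5·10⁵) that have a rational `2`-torsion point: `453` EDGES among the `966` KERNEL-ISO curves
(`rank3IsoRows`, one rational `2`-torsion point each) and `20` STARS `K_{1,3}` centred at the `20` full-`2`-torsion curves
(`rank3FullTwoTorsionRows`), every edge carrying a `ℚ`-isogeny (`IsoRow.isIsogenous_of_twoIsoMate`).

## What THIS file adds (zero new data; two `filterMap`s of row 47's decorated list, three small kernel checks, glue BY NAME)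

* §1 WHAT TRAVELS ALONG A `ℚ`-ISOGENY between two census curves, from theorems the tree PROVES (no hypothesis): the
  Mordell–Weil rank (`IsIsogenous.mordellWeilRank_eq`), the `L`-function, the analytic rank and the leading Taylor
  coefficient `L^{(r)}(E,1)/r!` (`IsIsogenous.LFunction_eq`, `analyticRank_eq_of_isIsogenous'`, `leadingLCoeff_eq_of_isIsogenous'`
  — Faltings/Tate isogeny invariance of `L`, Knapp Thm. 11.67, PROVED in the tree), finiteness of `Ш` (`IsIsogenous.shaFinite_iff_shaFinite`),
  the `p^∞`-Selmer and `Ш` coranks at every prime (`IsIsogenous.selmerCorank_eq`, `IsIsogenous.shaCorank_eq`, Greenberg), hence the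
  BSD RANK clause and RANK `∧` SHAFIN (`IsIsogenous.bsdRankFormula_iff`, `IsIsogenous.bsdRankFormula_and_shaFinite_iff`); and,
  granting ONLY Cassels' isogeny invariance of the BSD quotient (the named fact `bsdRHS_eq_of_isIsogenous`, Cassels 1965 /
  Milne ADT I.7.3 — NOT proved in the tree), the full triple RANK `∧` SHAFIN `∧` LEAD (`IsIsogenous.bsdTriple_iff_of_bsdRHS_eq`).
* §2 REPRESENTATIVES WITHOUT NEW DATA: `repRows` = the `453` forward-mated KERNEL-ISO rows (one end of each edge, read off row 47's
  decorated list `withNbrs rank3IsoRows` by `filterMap`), `predRows` = the predecessors of the `453` backward-mated rows; ONE kernel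
  identity `predRows.map aKey = repRows.map aKey` (the two ends of every edge are list neighbours, row 47) and the counts `453`,
  `453 + 20 = 473` with all `473` model keys distinct.
* §3 EVERY ONE OF THE `986` CURVES IS, OR IS `ℚ`-ISOGENOUS TO, ONE OF THE `473` REPRESENTATIVES (`453` edge ends + the `20` star
  centres), hypothesis-free (`rank3IsoRows_rep`, `Rank3Row.exists_rep`): from row 47's WALK 1 (`rank3IsoRows_mateWalk`) and §2.
* §4 THE BSD REDUCTION: for every census row `r` among the `986`, there is a REPRESENTATIVE census row `r′` with
  `r′ = r` as curves or `r ~ r′` over `ℚ`, and in either case RANK(r) ↔ RANK(r′), RANK ∧ SHAFIN (r) ↔ RANK ∧ SHAFIN (r′),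
  `Ш(r)` finite ↔ `Ш(r′)` finite, `r_an(r) = r_an(r′)`, `L(r,s) = L(r′,s)`, equal `p^∞`-Selmer coranks at every `p` — HYPOTHESIS-FREE —
  and BSD(r) ↔ BSD(r′) (the full triple) granting Cassels (`hC : bsdRHS_eq_of_isIsogenous`). So the BSD RANK `∧` SHAFIN question on
  the `986` two-torsion curves of the rank-3 table is `473` questions, not `986`; on the whole table `8 501 + 473 = 8 974`, not `9 487`.

## NOT claimed

No isogeny of odd degree is used or excluded (the `ℚ`-isogeny classes of the table may be coarser than the `2`-isogeny components:
`473` is an UPPER bound for the number of BSD-questions among the 986, not the class count of Cremona's table); no curve outside the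
table; Cassels' theorem (`bsdRHS_eq_of_isIsogenous`) is a hypothesis wherever the leading-term clause is moved; no value of any
`#Ш`, regulator, period or Tamagawa number; no claim that BSD holds for any curve of rank `3`.

## References

[cite: SilvermanAEC2009, III.4 Example 4.5, III.6] · [cite: CremonaAlgorithms1997, §3.6, §3.8, Table 1] ·
[cite: MilneADT2006, Ch. I, Thm. 7.3, Rmk. 7.4, Lemma 7.1] · [cite: Cassels1965ArithmeticVIII] ·
[cite: Knapp1993, Thm. 11.67] · [cite: GreenbergLNM1716, §1 pp. 54–57].
-/

set_option linter.dupNamespace false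
set_option autoImplicit false

namespace Summit.BirchSwinnertonDyer.BirchSwinnertonDyer.Rank2Observatory

open WeierstrassCurve Literature Literature.NumberTheory.EllipticCurves
open IsoLocal MateWalk

/-! ### §1 What travels along a `ℚ`-isogeny between two census curves (theorems of the tree, by name) -/

/-- **Along a `ℚ`-isogeny between two curves of the rank-3 table, HYPOTHESIS-FREE:** equal Mordell–Weil rank, equal
`L`-function, equal analytic rank, equal leading Taylor coefficient at `s = 1`, `Ш` finite ↔ `Ш` finite, RANK ↔ RANK,
RANK `∧` SHAFIN ↔ RANK `∧` SHAFIN. All seven are theorems PROVED in the tree (isogeny invariance of the rank; Faltings/Tate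
invariance of `L`, Knapp Thm. 11.67; invariance of the finiteness of `Ш`, Milne I.7.1).
[cite: MilneADT2006, Ch. I, Lemma 7.1, proof of Thm. 7.3] [cite: Knapp1993, Thm. 11.67] [cite: SilvermanAEC2009, III.6] -/
theorem Rank3Row.invariants_of_isIsogenous {r r' : Rank3Row} (hr : r ∈ rank3Table) (hr' : r' ∈ rank3Table)
    (hiso : IsIsogenous r.curve r'.curve) :
    haveI := isElliptic_of_mem hr; haveI := isElliptic_of_mem hr'
    r.curve.mordellWeilRank = r'.curve.mordellWeilRank ∧ r.curve.LFunction = r'.curve.LFunction ∧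
    r.curve.analyticRank = r'.curve.analyticRank ∧ r.curve.leadingLCoeff = r'.curve.leadingLCoeff ∧
    (r.curve.ShaFinite ↔ r'.curve.ShaFinite) ∧ (r.curve.BSDRankFormula ↔ r'.curve.BSDRankFormula) ∧
    (r.curve.BSDRankFormula ∧ r.curve.ShaFinite ↔ r'.curve.BSDRankFormula ∧ r'.curve.ShaFinite) := by
  haveI := isElliptic_of_mem hr; haveI := isElliptic_of_mem hr'
  exact ⟨hiso.mordellWeilRank_eq, hiso.LFunction_eq, analyticRank_eq_of_isIsogenous' hiso,
    leadingLCoeff_eq_of_isIsogenous' hiso, hiso.shaFinite_iff_shaFinite, hiso.bsdRankFormula_iff,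
    hiso.bsdRankFormula_and_shaFinite_iff⟩

/-- **Equal `p^∞`-Selmer corank and equal `Ш[p^∞]`-corank at every prime along a `ℚ`-isogeny between two census curves**,
hypothesis-free (Greenberg, LNM 1716 §1; PROVED in the tree: `IsIsogenous.selmerCorank_eq`, `IsIsogenous.shaCorank_eq`).
[cite: GreenbergLNM1716, §1 pp. 54–57] -/
theorem Rank3Row.selmerCorank_eq_of_isIsogenous {r r' : Rank3Row} (hr : r ∈ rank3Table) (hr' : r' ∈ rank3Table)
    (hiso : IsIsogenous r.curve r'.curve) (p : ℕ) [Fact p.Prime] :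
    haveI := isElliptic_of_mem hr; haveI := isElliptic_of_mem hr'
    r.curve.selmerCorank p = r'.curve.selmerCorank p ∧ r.curve.shaCorank p = r'.curve.shaCorank p := by
  haveI := isElliptic_of_mem hr; haveI := isElliptic_of_mem hr'
  exact ⟨hiso.selmerCorank_eq p, hiso.shaCorank_eq p⟩

/-- **The full BSD triple travels along a `ℚ`-isogeny between two census curves, granting ONLY Cassels' isogeny invariance
of the BSD quotient** (`hC : bsdRHS_eq_of_isIsogenous`, Cassels 1965 = Milne ADT I.7.3, a named fact NOT proved in the tree;
both census models are globally minimal, `Rank3Row.isGloballyMinimal_of_mem`): `BSD(r) ↔ BSD(r′)`.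
[cite: Cassels1965ArithmeticVIII] [cite: MilneADT2006, Ch. I, Thm. 7.3 and Rmk. 7.4] -/
theorem Rank3Row.bsdTriple_iff_of_isIsogenous (hC : bsdRHS_eq_of_isIsogenous) {r r' : Rank3Row} (hr : r ∈ rank3Table)
    (hr' : r' ∈ rank3Table) (hiso : IsIsogenous r.curve r'.curve) :
    haveI := isElliptic_of_mem hr; haveI := isElliptic_of_mem hr'
    r.curve.BSDTriple ↔ r'.curve.BSDTriple := by
  haveI := isElliptic_of_mem hr; haveI := isElliptic_of_mem hr'
  haveI := Rank3Row.isGloballyMinimal_of_mem hr; haveI := Rank3Row.isGloballyMinimal_of_mem hr'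
  exact hiso.bsdTriple_iff_of_bsdRHS_eq fun hs => (hC r.curve r'.curve hiso hs).2.symm

/-! ### §2 Representatives read off row 47's decorated list (no new data) -/

/-- The `453` FORWARD-MATED KERNEL-ISO rows: one end of each of the `453` edges of the `2`-isogeny graph (row 47, WALK 3).
[cite: CremonaAlgorithms1997, §3.8 and Table 1] -/
noncomputable def repRows : List IsoRow := (withNbrs rank3IsoRows).filterMap fun t => if mateN t then some t.1 else none

/-- The PREDECESSORS of the `453` BACKWARD-MATED KERNEL-ISO rows (the other reading of the same `453` edges).
[cite: CremonaAlgorithms1997, §3.8 and Table 1] -/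
noncomputable def predRows : List IsoRow := (withNbrs rank3IsoRows).filterMap fun t => if mateP t then t.2.1 else none

set_option maxHeartbeats 4000000 in
/-- KERNEL: `453` representatives. [cite: CremonaAlgorithms1997, §3.8 and Table 1] -/
theorem repRows_length : repRows.length = 453 := by
  decide +kernel

set_option maxHeartbeats 4000000 in
/-- KERNEL (the one identity of this file): the predecessor of every backward-mated row is the forward-mated row of the same
edge — as model keys, in order, `predRows = repRows`. [cite: CremonaAlgorithms1997, §3.8 and Table 1] -/
theorem predRows_keys_eq : predRows.map IsoRow.aKey = repRows.map IsoRow.aKey := by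
  decide +kernel

set_option maxHeartbeats 4000000 in
/-- KERNEL: the `453 + 20 = 473` representative model keys (edge ends and star centres) are pairwise distinct.
[cite: CremonaAlgorithms1997, §3.8 and Table 1] -/
theorem repKeys_nodup : (repRows.map IsoRow.aKey ++ rank3FullTwoTorsionRows.map aKey₃).Nodup ∧
    (repRows.map IsoRow.aKey ++ rank3FullTwoTorsionRows.map aKey₃).length = 473 := by
  constructor <;> decide +kernel

/-- Representatives are KERNEL-ISO rows (hence census curves of certified rank `3`). [folklore] -/
theorem mem_rank3IsoRows_of_mem_repRows {P : IsoRow} (hP : P ∈ repRows) : P ∈ rank3IsoRows := by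
  obtain ⟨t, ht, h⟩ := List.mem_filterMap.mp hP
  by_cases hm : mateN t = true
  · simp only [hm, if_true, Option.some.injEq] at h
    exact h ▸ (mem_withNbrs ht).1
  · simp [hm] at h

/-- Equal model keys ⇒ equal models (two KERNEL-ISO rows). [folklore] -/
theorem IsoRow.curve_eq_of_aKey_eq_aKey {R R' : IsoRow} (h : R.aKey = R'.aKey) : R.curve = R'.curve := by
  simp only [IsoRow.aKey, Prod.mk.injEq] at h
  obtain ⟨h₁, h₂, h₃, h₄, h₆⟩ := h
  simp only [IsoRow.curve, h₁, h₂, h₃, h₄, h₆]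

/-- A predecessor of a backward-mated row has the model of a representative. [folklore] -/
theorem exists_rep_of_mem_predRows {P : IsoRow} (hP : P ∈ predRows) : ∃ P' ∈ repRows, P'.curve = P.curve := by
  have hk : P.aKey ∈ repRows.map IsoRow.aKey := predRows_keys_eq ▸ List.mem_map.mpr ⟨P, hP, rfl⟩
  obtain ⟨P', hP', hk'⟩ := List.mem_map.mp hk
  exact ⟨P', hP', IsoRow.curve_eq_of_aKey_eq_aKey hk'⟩

/-! ### §3 Every one of the `986` curves is, or is `ℚ`-isogenous to, one of the `473` representatives -/

/-- **The 966 KERNEL-ISO curves**: each is a representative, or `ℚ`-isogenous to a representative (its forward-mated list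
predecessor), or `ℚ`-isogenous to one of the 20 full-`2`-torsion census curves (the centre of its star). Hypothesis-free: row 47's
WALK 1 + the key identity of §2 + soundness of the mate test. [cite: SilvermanAEC2009, III.4 Example 4.5] [cite: CremonaAlgorithms1997, §3.6, §3.8] -/
theorem rank3IsoRows_rep : ∀ R ∈ rank3IsoRows,
    R ∈ repRows ∨ (∃ P ∈ repRows, IsIsogenous R.curve P.curve) ∨
      (∃ r' ∈ rank3FullTwoTorsionRows, IsIsogenous R.curve r'.curve) := by
  intro R hR
  obtain ⟨t, ht, rfl⟩ := exists_withNbrsAux none rank3IsoRows R hR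
  have hwalk := List.all_eq_true.mp rank3IsoRows_mateWalk t ht
  have hchk : ∀ R' ∈ rank3IsoRows, R'.check3 = true := fun R' h => List.all_eq_true.mp rank3IsoRows_check R' h
  have hchkF : ∀ R' ∈ rank3FullTwoTorsionIsoRows, R'.check3 = true :=
    fun R' h => List.all_eq_true.mp rank3FullTwoTorsionIsoRows_check R' h
  obtain ⟨ht1, hp, -⟩ := mem_withNbrs ht
  simp only [Bool.or_eq_true] at hwalk
  rcases hwalk with (hN | hP) | hE
  · exact Or.inl (List.mem_filterMap.mpr ⟨t, ht, by simp [hN]⟩)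
  · obtain ⟨R₀, p, n⟩ := t
    cases p with
    | none => simp [mateP] at hP
    | some P =>
      have hPmem : P ∈ rank3IsoRows := hp P rfl
      have hiso := (IsoRow.isIsogenous_of_twoIsoMate R₀ P (hchk R₀ ht1) (hchk P hPmem) hP).1
      have hPpred : P ∈ predRows := List.mem_filterMap.mpr ⟨(R₀, some P, n), ht, by simp [hP]⟩
      obtain ⟨P', hP', hc⟩ := exists_rep_of_mem_predRows hPpred
      exact Or.inr (Or.inl ⟨P', hP', by rw [hc]; exact hiso⟩)
  · obtain ⟨F, hF, hm⟩ := List.any_eq_true.mp hE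
    have hiso := (IsoRow.isIsogenous_of_twoIsoMate t.1 F (hchk t.1 ht1) (hchkF F hF) hm).1
    obtain ⟨r', hr', hc, -⟩ := rank3FullTwoTorsionIsoRows_census F hF
    exact Or.inr (Or.inr ⟨r', hr', hc ▸ hiso⟩)

/-- Equal models ⇒ equal model keys (a KERNEL-ISO row and a census row). [folklore] -/
theorem aKey_eq_of_curve_eq {R : IsoRow} {r : Rank3Row} (h : r.curve = R.curve) : R.aKey = aKey₃ r := by
  simp only [Rank3Row.curve, IsoRow.curve, WeierstrassCurve.mk.injEq, Int.cast_inj] at h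
  obtain ⟨h₁, h₂, h₃, h₄, h₆⟩ := h
  simp only [IsoRow.aKey, aKey₃, h₁, h₂, h₃, h₄, h₆]

/-- **REPRESENTATIVE census rows** — `aKey₃ r ∈ repRows.map IsoRow.aKey` (an edge end) or `r ∈ rank3FullTwoTorsionRows` (a star
centre) — have kernel-certified rank `3`. [cite: SilvermanTate2015, §3.6] -/
theorem Rank3Row.rank_eq_three_of_rep {r : Rank3Row}
    (h : aKey₃ r ∈ repRows.map IsoRow.aKey ∨ r ∈ rank3FullTwoTorsionRows) : r.curve.mordellWeilRank = 3 := by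
  rcases h with h | h
  · obtain ⟨P, hP, hk⟩ := List.mem_map.mp h
    exact Rank3Row.mordellWeilRank_eq_three_of_aKey_mem (List.mem_map.mpr ⟨P, mem_rank3IsoRows_of_mem_repRows hP, hk⟩)
  · exact mordellWeilRank_eq_three_of_mem_fullTwoTorsionRows r h

/-- **Every one of the 986 is, or is `ℚ`-isogenous to, a REPRESENTATIVE census row**, hypothesis-free. The 986 = the census rows
whose model is a KERNEL-ISO model (966) or which are full-`2`-torsion rows (20) — exactly the census curves with `E(ℚ)[2] ≠ 0`
(KCI rows 23/46). [cite: SilvermanAEC2009, III.4 Example 4.5] [cite: CremonaAlgorithms1997, §3.6, §3.8] -/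
theorem Rank3Row.exists_rep {r : Rank3Row} (hr : r ∈ rank3Table)
    (h : aKey₃ r ∈ rank3IsoRows.map IsoRow.aKey ∨ r ∈ rank3FullTwoTorsionRows) :
    ∃ r' ∈ rank3Table, (aKey₃ r' ∈ repRows.map IsoRow.aKey ∨ r' ∈ rank3FullTwoTorsionRows) ∧
      (r'.curve = r.curve ∨ IsIsogenous r.curve r'.curve) := by
  rcases h with h | h
  · obtain ⟨R, hR, hk⟩ := List.mem_map.mp h
    have hc : r.curve = R.curve := curve_eq_of_aKey_eq hk
    rcases rank3IsoRows_rep R hR with hrep | ⟨P, hP, hiso⟩ | ⟨r', hr', hiso⟩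
    · exact ⟨r, hr, Or.inl (List.mem_map.mpr ⟨R, hrep, hk⟩), Or.inl rfl⟩
    · obtain ⟨r₀, hr₀, hc₀⟩ := rank3IsoRows_census P (mem_rank3IsoRows_of_mem_repRows hP)
      exact ⟨r₀, hr₀, Or.inl (List.mem_map.mpr ⟨P, hP, aKey_eq_of_curve_eq hc₀⟩), Or.inr (by rw [hc, hc₀]; exact hiso)⟩
    · exact ⟨r', mem_rank3Table_of_mem_fullTwoTorsionRows r' hr', Or.inr hr', Or.inr (by rw [hc]; exact hiso)⟩
  · exact ⟨r, hr, Or.inr h, Or.inl rfl⟩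

/-! ### §4 The BSD reduction: `986` curves, `473` representatives -/

/-- **THE BSD REDUCTION, HYPOTHESIS-FREE.** For every curve `E_r` of the rank-3 table with a rational `2`-torsion model there is a
REPRESENTATIVE census curve `E_{r′}` (one of `453` edge ends or `20` star centres), equal or `ℚ`-isogenous to it, with:
RANK(r) ↔ RANK(r′); RANK ∧ SHAFIN (r) ↔ RANK ∧ SHAFIN (r′); `Ш(E_r)` finite ↔ `Ш(E_{r′})` finite; equal analytic ranks; equal
`L`-functions; equal leading Taylor coefficients at `s = 1`. (Equal `p^∞`-Selmer / `Ш[p^∞]` coranks along the isogeny: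
`Rank3Row.selmerCorank_eq_of_isIsogenous`.) [cite: MilneADT2006, Ch. I, Lemma 7.1] [cite: Knapp1993, Thm. 11.67]
[cite: CremonaAlgorithms1997, §3.8] -/
theorem Rank3Row.bsd_reduction {r : Rank3Row} (hr : r ∈ rank3Table)
    (h : aKey₃ r ∈ rank3IsoRows.map IsoRow.aKey ∨ r ∈ rank3FullTwoTorsionRows) :
    ∃ r' ∈ rank3Table, (aKey₃ r' ∈ repRows.map IsoRow.aKey ∨ r' ∈ rank3FullTwoTorsionRows) ∧
      (r'.curve = r.curve ∨ IsIsogenous r.curve r'.curve) ∧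
      (r.curve.BSDRankFormula ↔ r'.curve.BSDRankFormula) ∧
      (r.curve.BSDRankFormula ∧ r.curve.ShaFinite ↔ r'.curve.BSDRankFormula ∧ r'.curve.ShaFinite) ∧
      (r.curve.ShaFinite ↔ r'.curve.ShaFinite) ∧ r.curve.analyticRank = r'.curve.analyticRank ∧
      r.curve.LFunction = r'.curve.LFunction ∧ r.curve.leadingLCoeff = r'.curve.leadingLCoeff := by
  obtain ⟨r', hr', hrep, hc | hiso⟩ := Rank3Row.exists_rep hr h
  · exact ⟨r', hr', hrep, Or.inl hc, by rw [hc], by rw [hc], by rw [hc], by rw [hc], by rw [hc], by rw [hc]⟩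
  · obtain ⟨-, hL, han, hlead, hsha, hrank, hrs⟩ := Rank3Row.invariants_of_isIsogenous hr hr' hiso
    exact ⟨r', hr', hrep, Or.inr hiso, hrank, hrs, hsha, han, hL, hlead⟩

/-- **THE FULL TRIPLE, granting ONLY Cassels** (`hC : bsdRHS_eq_of_isIsogenous`): BSD(E_r) ↔ BSD(E_{r′}) for a representative `r′`.
[cite: Cassels1965ArithmeticVIII] [cite: MilneADT2006, Ch. I, Thm. 7.3] [cite: CremonaAlgorithms1997, §3.8] -/
theorem Rank3Row.bsdTriple_reduction (hC : bsdRHS_eq_of_isIsogenous) {r : Rank3Row} (hr : r ∈ rank3Table)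
    (h : aKey₃ r ∈ rank3IsoRows.map IsoRow.aKey ∨ r ∈ rank3FullTwoTorsionRows) :
    ∃ r' ∈ rank3Table, (aKey₃ r' ∈ repRows.map IsoRow.aKey ∨ r' ∈ rank3FullTwoTorsionRows) ∧
      (r'.curve = r.curve ∨ IsIsogenous r.curve r'.curve) ∧ (r.curve.BSDTriple ↔ r'.curve.BSDTriple) := by
  obtain ⟨r', hr', hrep, hc | hiso⟩ := Rank3Row.exists_rep hr h
  · exact ⟨r', hr', hrep, Or.inl hc, by rw [hc]⟩
  · exact ⟨r', hr', hrep, Or.inr hiso, Rank3Row.bsdTriple_iff_of_isIsogenous hC hr hr' hiso⟩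

/-- **Summary — BSD along the `2`-isogeny graph of the rank-3 table.** (i) Every census row with a rational `2`-torsion model
(`966 + 20 = 986` curves) has a REPRESENTATIVE census row, equal or `ℚ`-isogenous, with RANK ∧ SHAFIN (r) ↔ RANK ∧ SHAFIN (r′),
hypothesis-free; (ii) the representatives: `453` edge ends, and together with the `20` star centres `473` pairwise distinct models;
(iii) `966 + 20 = 986`. So RANK ∧ SHAFIN on the `986` is at most `473` questions (on the whole table at most `8 501 + 473 = 8 974`).
[cite: MilneADT2006, Ch. I, Lemma 7.1, Thm. 7.3] [cite: CremonaAlgorithms1997, §3.6, §3.8, Table 1] -/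
theorem rank3_twoTorsion_bsdClasses :
    (∀ r ∈ rank3Table, (aKey₃ r ∈ rank3IsoRows.map IsoRow.aKey ∨ r ∈ rank3FullTwoTorsionRows) →
      ∃ r' ∈ rank3Table, (aKey₃ r' ∈ repRows.map IsoRow.aKey ∨ r' ∈ rank3FullTwoTorsionRows) ∧
        (r'.curve = r.curve ∨ IsIsogenous r.curve r'.curve) ∧
        (r.curve.BSDRankFormula ∧ r.curve.ShaFinite ↔ r'.curve.BSDRankFormula ∧ r'.curve.ShaFinite)) ∧
    repRows.length = 453 ∧
    (repRows.map IsoRow.aKey ++ rank3FullTwoTorsionRows.map aKey₃).Nodup ∧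
    (repRows.map IsoRow.aKey ++ rank3FullTwoTorsionRows.map aKey₃).length = 473 ∧
    rank3IsoRows.length + rank3FullTwoTorsionRows.length = 986 := by
  refine ⟨fun r hr h => ?_, repRows_length, repKeys_nodup.1, repKeys_nodup.2, rank3_twoTorsion_doors_count⟩
  obtain ⟨r', hr', hrep, hc, -, hrs, -⟩ := Rank3Row.bsd_reduction hr h
  exact ⟨r', hr', hrep, hc, hrs⟩

end Summit.BirchSwinnertonDyer.BirchSwinnertonDyer.Rank2Observatory
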